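import Mathlib
import HarnessLib
import Literature.Analysis.SpecialFunctions.DigammaStirlingSecondOrder

/-!
# The cusp wall's emission phase: `arg(L + iπ/2) = arctan(π/(2L)) ≤ π/(2L)`

Helper file (`--supports stmt-RiemannHypothesis-0098`), elementary, no definitions.  Seat rh-explicit-weil-5 gen13 (file of record
`HOME/rh-explicit-weil-5/WEIL5-XFOLD.md` §5B «H_PHASE»; sealed ledger PREREG-XFOLD-ADD2-weil5-g13 62490a4f…).

Context (documentation only).  The Weil minimiser's wall is the cusp `C·𝔉(2πs)`, `𝔉(y) ≈ [π(log(1/y) − γ_E)]^{-1/2}`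
(`Theorems/WeilWallCusp.lean`); its radiation at height `γ` carries, relative to a jump wall's `1/(iγ)`, the factor
`𝔉(2πe^{-γ_E ∓ iπ/2}/γ) ≈ [π(L ± iπ/2)]^{-1/2}` with `L = log(γ/2π)` (`Theorems/WeilWallCusp.lean`, WALL §1(f)), i.e. a phase
`∓ ½·arg(L + iπ/2)` per wall and a modulus correction `(1 + (π/2L)²)^{-1/4}`.  The two walls of the even minimiser therefore
interfere with an extra inter-ray phase of size `arg(L + iπ/2) = arctan(π/(2L))`, at most `π/(2L)` — the «H_PHASE» term tested
per zero in WEIL5-XFOLD §5B.  This file certifies exactly these closed forms: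

* `cuspFactor_arg`       : `arg(L + (π/2)i) = arctan(π/(2L))` for `L > 0`;
* `cuspFactor_arg_pos`, `cuspFactor_arg_lt` : `0 < arctan(π/(2L)) < π/2`;
* `cuspFactor_arg_le`    : `arctan(π/(2L)) ≤ π/(2L)` (so each wall's phase `½·arg ≤ π/(4L)`);
* `cuspFactor_normSq`    : `|L + (π/2)i|² = L² + π²/4 = L²(1 + (π/(2L))²)`.

Standard axioms only; no `sorry`.
-/

set_option linter.dupNamespace false
set_option autoImplicit false

noncomputable section

open Real Complex

namespace Summit.RiemannHypothesis.RiemannHypothesis.Theorems.WeilCuspPhase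

/-- The complex number `L + (π/2)·i` that the cusp's Mellin factor raises to the power `−1/2`. -/
private theorem re_im (L : ℝ) : ((L : ℂ) + (π / 2 : ℝ) * I).re = L ∧ ((L : ℂ) + (π / 2 : ℝ) * I).im = π / 2 := by
  constructor <;> simp

/-- THE PHASE: for `L > 0`, `arg(L + (π/2)i) = arctan(π/(2L))`. -/
theorem cuspFactor_arg (L : ℝ) (hL : 0 < L) :
    Complex.arg ((L : ℂ) + (π / 2 : ℝ) * I) = Real.arctan (π / (2 * L)) := by
  have h := Literature.Analysis.SpecialFunctions.Complex.arg_eq_arctan_of_re_pos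
    (z := (L : ℂ) + (π / 2 : ℝ) * I) (by simpa using hL)
  rw [h, (re_im L).1, (re_im L).2]
  congr 1
  field_simp

/-- The phase is positive … -/
theorem cuspFactor_arg_pos (L : ℝ) (hL : 0 < L) : 0 < Real.arctan (π / (2 * L)) :=
  Real.arctan_pos.mpr (by positivity)

/-- … smaller than a right angle … -/
theorem cuspFactor_arg_lt (L : ℝ) : Real.arctan (π / (2 * L)) < π / 2 :=
  Real.arctan_lt_pi_div_two _

/-- … and at most `π/(2L)`: the two-wall inter-ray phase is `O(1/log γ)`; each wall carries half of it, `≤ π/(4L)`. -/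
theorem cuspFactor_arg_le (L : ℝ) (hL : 0 < L) : Real.arctan (π / (2 * L)) ≤ π / (2 * L) := by
  have hx : 0 ≤ π / (2 * L) := by positivity
  have h1 : 0 ≤ Real.arctan (π / (2 * L)) := Real.arctan_nonneg.2 hx
  have h2 := Real.le_tan h1 (Real.arctan_lt_pi_div_two _)
  rwa [Real.tan_arctan] at h2

/-- Half the phase per wall is at most `π/(4L)`. -/
theorem cuspWall_phase_le (L : ℝ) (hL : 0 < L) : Real.arctan (π / (2 * L)) / 2 ≤ π / (4 * L) := by
  have := cuspFactor_arg_le L hL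
  have h4 : π / (4 * L) = π / (2 * L) / 2 := by ring
  rw [h4]; linarith

/-- THE MODULUS: `|L + (π/2)i|² = L² + π²/4`, i.e. the cusp factor's size correction is `(1 + (π/(2L))²)^{-1/4}` relative to `L^{-1/2}`. -/
theorem cuspFactor_normSq (L : ℝ) : Complex.normSq ((L : ℂ) + (π / 2 : ℝ) * I) = L ^ 2 + π ^ 2 / 4 := by
  rw [Complex.normSq_apply, (re_im L).1, (re_im L).2]; ring

/-- The same modulus in the factored form used by the tables: `L² + π²/4 = L²·(1 + (π/(2L))²)` for `L ≠ 0`. -/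
theorem cuspFactor_normSq_factored (L : ℝ) (hL : L ≠ 0) : L ^ 2 + π ^ 2 / 4 = L ^ 2 * (1 + (π / (2 * L)) ^ 2) := by
  field_simp
  ring

end Summit.RiemannHypothesis.RiemannHypothesis.Theorems.WeilCuspPhase

end
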